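import Literature.Algebra.Polynomial.HandelmanPolytope

/-!
# Handelman 1988, §III: an almost non-vanishing element that is not positive

Let `β_j = c_j + ∑_i a_{j i} x_i` (`j ∈ J`) be finitely many affine polynomials in the real
variables `x_i` (`i ∈ ι`), and `K = {x | β_j(x) ≥ 0 for all j} ⊆ ℝ^ι` the compact polyhedron with
non-empty interior they define, as in `Literature/Algebra/Polynomial/HandelmanPolytope.lean`
(`affineForm`, `handelman_polytope`). Handelman's theorem [cite: Handelman1988, Thm I.3] represents
every polynomial *strictly positive* on `K` as a combination with coefficients `≥ 0` of the products
`∏_j β_j^{w(j)}`; his necessary condition [cite: Handelman1988, §III (necessary condition)]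
(`coeff_repr_eq_zero_of_eval_eq_zero` there) shows that a represented polynomial cannot vanish at
an interior point unless it is zero. Section III of the paper then shows that vanishing *only at a
vertex* does not suffice either:

* `exists_isSumSq_eq_zero_iff_vertex_not_repr` — [cite: Handelman1988, §III] (p. 56, items
  (i)–(iv)): if `K` has dimension `d ≥ 2` (here: `ι` has at least two elements and `K` has
  interior), there is a polynomial `f` that is (i) non-negative (on `K`, indeed everywhere),
  (ii) a sum of squares of polynomials, (iii) vanishes on `K` exactly at one vertex `v` of `K`
  (`v ∈ extremePoints ℝ K` and `{x ∈ K | f x = 0} = {v}`), and (iv) is **not** of the form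
  `∑_w r_w ∏_j β_j^{w(j)}` with all `r_w ≥ 0`.

The statement is Handelman's. The witness and the proof are ours and differ from the paper's
(Handelman takes `f_N = (N ∑_{i<d} γ_i − γ_d)² + (∑_{i<d} γ_i − ψ ∑_{i<d} γ_i)²` for large `N`
and argues with the order ideals of his §II): we inscribe in `K` the simplex with apex the vertex
`v` and edge points `p_i = x₀ + ρ e_i` next to an interior point `x₀` (`vtxPoint`, with explicit
coordinates `vtxCoord` — a Sherman–Morrison inverse written out by hand), take
`f = (γ_{i₁} − γ_{i₂})² + ∑_i γ_i²` in these coordinates (`vtxWitness`, `sqForm`), and refute a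
representation by transporting it to the coordinates `y = γ(x)` — where every `β_j` becomes
`b_j + ∑_i (β_j(p_i) − b_j) y_i` with `b_j = β_j(v) ≥ 0`, `β_j(p_i) ≥ 0` — and grading by the
scaling `y ↦ t·y` (`scaleHom`): the words with no factor vanishing at `v` are killed by the
`t⁰`-coefficient, those with one such factor by the `t¹`-coefficient, and the `t²`-coefficient
then writes the quadratic form `F = (y_{i₁} − y_{i₂})² + ∑ y_i²` as a combination with
coefficients `≥ 0` of products of linear forms with coefficients `≥ 0`
(`nonnegCoeff_of_sum_eq_X_sq_mul`, `scaleHom_word`, `sum_prod_vertexForm_ne_sqForm`) —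
impossible, the coefficient of `y_{i₁} y_{i₂}` in `F` being `−2` (`coeff_sqForm`).

Auxiliary notions (proof infrastructure, all `private`, in the sub-namespace `HandelmanSectionIII`,
[folklore]):
`NonnegCoeff` (all coefficients `≥ 0`) and
its closure properties; `scaleHom`; `sqForm`; `vtxCoord` / `vtxPoint` and the two inverse
identities `eval_vtxPoint_vtxCoord`, `vtxPoint_eval_vtxCoord`; `affine_vtxPoint` (an affine
function in the simplex coordinates).

Not formalised here: Handelman's own witnesses `f_N` and the order-ideal description of the
positive cone at a vertex [cite: Handelman1988, §II]; the converse direction of §III (which zero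
sets on `∂K` do occur).

## References

* D. Handelman, *Representing polynomials by positive linear functions on compact convex
  polyhedra*, Pacific J. Math. 132 (1988), no. 1, 35–62, §III "An almost non-vanishing element
  that is not positive", p. 56 [cite: Handelman1988, §III].
-/

noncomputable section

open MvPolynomial Finset Matrix
open scoped BigOperators Polynomial

namespace Literature.Algebra.Polynomial

/-! ### Proof infrastructure (sub-namespace `HandelmanSectionIII`, all declarations `private`) -/
namespace HandelmanSectionIII

section NonnegCoeff

variable {ι : Type*}

/-- All coefficients of a real polynomial are `≥ 0`. [folklore] -/
private def NonnegCoeff (p : MvPolynomial ι ℝ) : Prop := ∀ m, 0 ≤ coeff m p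

namespace NonnegCoeff

/-- A non-negative constant has non-negative coefficients. [folklore] -/
private theorem C_nonneg {r : ℝ} (hr : 0 ≤ r) : NonnegCoeff (C r : MvPolynomial ι ℝ) := fun m => by
  classical
  rw [coeff_C]; split_ifs <;> simp [hr]

/-- `1` has non-negative coefficients. [folklore] -/
private theorem one : NonnegCoeff (1 : MvPolynomial ι ℝ) := by
  simpa using (C_nonneg (ι := ι) zero_le_one)

/-- A variable has non-negative coefficients. [folklore] -/
private theorem X (i : ι) : NonnegCoeff (X i : MvPolynomial ι ℝ) := fun m => by
  classical
  rw [coeff_X]; split_ifs <;> simp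

/-- Closure of `NonnegCoeff` under addition. [folklore] -/
private theorem add {p q : MvPolynomial ι ℝ} (hp : NonnegCoeff p) (hq : NonnegCoeff q) :
    NonnegCoeff (p + q) := fun m => by
  rw [coeff_add]; exact add_nonneg (hp m) (hq m)

/-- Closure of `NonnegCoeff` under multiplication. [folklore] -/
private theorem mul {p q : MvPolynomial ι ℝ} (hp : NonnegCoeff p) (hq : NonnegCoeff q) :
    NonnegCoeff (p * q) := fun m => by
  classical
  rw [coeff_mul]; exact sum_nonneg fun x _ => mul_nonneg (hp _) (hq _)

/-- Closure of `NonnegCoeff` under finite sums. [folklore] -/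
private theorem sum {κ : Type*} {s : Finset κ} {g : κ → MvPolynomial ι ℝ}
    (h : ∀ k ∈ s, NonnegCoeff (g k)) : NonnegCoeff (∑ k ∈ s, g k) := fun m => by
  rw [coeff_sum]; exact sum_nonneg fun k hk => h k hk m

/-- Closure of `NonnegCoeff` under finite products. [folklore] -/
private theorem prod {κ : Type*} {s : Finset κ} {g : κ → MvPolynomial ι ℝ}
    (h : ∀ k ∈ s, NonnegCoeff (g k)) : NonnegCoeff (∏ k ∈ s, g k) := by
  classical
  induction s using Finset.induction_on with
  | empty => simpa using (one (ι := ι))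
  | insert a s ha ih =>
    rw [prod_insert ha]
    exact mul (h a (mem_insert_self _ _)) (ih fun k hk => h k (mem_insert_of_mem hk))

/-- Closure of `NonnegCoeff` under powers. [folklore] -/
private theorem pow {p : MvPolynomial ι ℝ} (hp : NonnegCoeff p) (n : ℕ) : NonnegCoeff (p ^ n) := by
  induction n with
  | zero => simpa using (one (ι := ι))
  | succ n ih => rw [pow_succ]; exact mul ih hp

/-- A sum of polynomials with non-negative coefficients vanishes only if every summand does.
[folklore] -/
private theorem eq_zero_of_sum_eq_zero {κ : Type*} {s : Finset κ} {g : κ → MvPolynomial ι ℝ}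
    (h : ∀ k ∈ s, NonnegCoeff (g k)) (h0 : ∑ k ∈ s, g k = 0) : ∀ k ∈ s, g k = 0 := by
  intro k hk
  ext m
  have hm := congrArg (coeff m) h0
  rw [coeff_sum, coeff_zero] at hm
  rw [coeff_zero]
  exact (sum_eq_zero_iff_of_nonneg fun k hk => h k hk m).mp hm k hk

end NonnegCoeff

end NonnegCoeff

section Scaling

variable {ι : Type*}

/-- The scaling homomorphism `y_i ↦ t·y_i`, `ℝ[y] → ℝ[y][t]`: it sends a polynomial to the
generating polynomial `∑_k t^k p_k` of its homogeneous components `p_k`. [folklore] -/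
private def scaleHom : MvPolynomial ι ℝ →ₐ[ℝ] (MvPolynomial ι ℝ)[X] :=
  aeval fun i => Polynomial.C (X i) * Polynomial.X

/-- `scaleHom (y_i) = y_i · t`. [folklore] -/
@[simp] private theorem scaleHom_X (i : ι) :
    scaleHom (MvPolynomial.X i : MvPolynomial ι ℝ) = Polynomial.C (X i) * Polynomial.X := by
  simp [scaleHom]

/-- `scaleHom` fixes constants. [folklore] -/
@[simp] private theorem scaleHom_C (r : ℝ) :
    scaleHom (C r : MvPolynomial ι ℝ) = Polynomial.C (C r) := by
  rw [scaleHom, ← MvPolynomial.algebraMap_eq, AlgHom.commutes, Polynomial.algebraMap_apply,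
    MvPolynomial.algebraMap_eq]

/-- On an affine-linear polynomial `b + ∑ e_i y_i` the scaling hom gives `b + t·(∑ e_i y_i)`.
[folklore] -/
private theorem scaleHom_affine [Fintype ι] (b : ℝ) (e : ι → ℝ) :
    scaleHom (C b + ∑ i, C (e i) * MvPolynomial.X i : MvPolynomial ι ℝ) =
      Polynomial.C (C b) + Polynomial.X * Polynomial.C (∑ i, C (e i) * MvPolynomial.X i) := by
  rw [map_add, scaleHom_C, map_sum, map_sum, Finset.mul_sum]
  congr 1
  refine sum_congr rfl fun i _ => ?_
  rw [map_mul, scaleHom_C, scaleHom_X, map_mul]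
  ring

/-- Coefficients of `t^δ · (M · (κ + t·G))`: zero below `t^δ`, and `κ M` at `t^δ`. [folklore] -/
private theorem coeff_X_pow_mul_of_lt (δ : ℕ) (M : MvPolynomial ι ℝ) (κ : ℝ)
    (G : (MvPolynomial ι ℝ)[X])
    {k : ℕ} (hk : k < δ) :
    (Polynomial.X ^ δ * (Polynomial.C M * (Polynomial.C (C κ) + Polynomial.X * G))).coeff k
      = 0 := by
  rw [Polynomial.coeff_X_pow_mul', if_neg (not_le.mpr hk)]

/-- The `t^δ`-coefficient of `t^δ · (M · (κ + t·G))` is `κ M`. [folklore] -/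
private theorem coeff_X_pow_mul_self (δ : ℕ) (M : MvPolynomial ι ℝ) (κ : ℝ)
    (G : (MvPolynomial ι ℝ)[X]) :
    (Polynomial.X ^ δ * (Polynomial.C M * (Polynomial.C (C κ) + Polynomial.X * G))).coeff δ
      = C κ * M := by
  rw [Polynomial.coeff_X_pow_mul', if_pos le_rfl, Nat.sub_self, Polynomial.coeff_C_mul,
    Polynomial.coeff_add, Polynomial.coeff_C_zero, Polynomial.mul_coeff_zero,
    Polynomial.coeff_X_zero, zero_mul, add_zero, mul_comm]

/-- **The graded argument.** [folklore] If `∑_w r_w T_w = t² F` in `ℝ[y][t]`, where `r_w ≥ 0`, each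
`T_w` vanishes below `t^{δ_w}` with `t^{δ_w}`-coefficient `N_w ≥ 0` (coefficientwise), and
`r_w N_w = 0` forces `r_w T_w = 0`, then `F` has non-negative coefficients: comparing the
coefficients of `t^0`, `t^1` kills the words with `δ_w ≤ 1`, and the coefficient of `t^2` then
exhibits `F` as `∑_{δ_w = 2} r_w N_w`. -/
private theorem nonnegCoeff_of_sum_eq_X_sq_mul {W : Type*} (s : Finset W) (r : W → ℝ)
    (hr : ∀ w ∈ s, 0 ≤ r w) (T : W → (MvPolynomial ι ℝ)[X]) (δ : W → ℕ)
    (N : W → MvPolynomial ι ℝ) (hN : ∀ w ∈ s, NonnegCoeff (N w))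
    (ha : ∀ w ∈ s, ∀ k < δ w, (T w).coeff k = 0) (hb : ∀ w ∈ s, (T w).coeff (δ w) = N w)
    (hc : ∀ w ∈ s, C (r w) * N w = 0 → Polynomial.C (C (r w)) * T w = 0)
    (F : MvPolynomial ι ℝ)
    (hE : ∑ w ∈ s, Polynomial.C (C (r w)) * T w = Polynomial.X ^ 2 * Polynomial.C F) :
    NonnegCoeff F := by
  classical
  -- the coefficient of `t^k`, once the words with `δ_w < k` are known to contribute nothing
  have hcoeff : ∀ k, (∀ w ∈ s, δ w < k → Polynomial.C (C (r w)) * T w = 0) →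
      (Polynomial.X ^ 2 * Polynomial.C F : (MvPolynomial ι ℝ)[X]).coeff k =
        ∑ w ∈ s.filter (fun w => δ w = k), C (r w) * N w := by
    intro k hkill
    rw [← hE, Polynomial.finsetSum_coeff, sum_filter]
    refine sum_congr rfl fun w hw => ?_
    rcases lt_trichotomy (δ w) k with hlt | heq | hgt
    · rw [hkill w hw hlt, Polynomial.coeff_zero, if_neg hlt.ne]
    · rw [if_pos heq, Polynomial.coeff_C_mul, ← heq, hb w hw]
    · rw [if_neg hgt.ne', Polynomial.coeff_C_mul, ha w hw k hgt, mul_zero]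
  have hterm : ∀ w ∈ s, NonnegCoeff (C (r w) * N w) :=
    fun w hw => (NonnegCoeff.C_nonneg (hr w hw)).mul (hN w hw)
  -- words with `δ_w < k` contribute nothing, for `k = 0, 1, 2`
  have hkill : ∀ k ≤ 2, ∀ w ∈ s, δ w < k → Polynomial.C (C (r w)) * T w = 0 := by
    intro k hk
    induction k with
    | zero => intro w _ h; exact absurd h (Nat.not_lt_zero _)
    | succ k ih =>
      have hk' : k < 2 := Nat.lt_of_succ_le hk
      have ih' := ih (Nat.le_of_succ_le hk)
      have hzero : ∑ w ∈ s.filter (fun w => δ w = k), C (r w) * N w = 0 := by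
        rw [← hcoeff k ih', Polynomial.coeff_X_pow_mul', if_neg (not_le.mpr hk')]
      have hvan := NonnegCoeff.eq_zero_of_sum_eq_zero
        (fun w hw => hterm w (mem_filter.mp hw).1) hzero
      intro w hw hlt
      rcases Nat.lt_succ_iff_lt_or_eq.mp hlt with h | h
      · exact ih' w hw h
      · exact hc w hw (hvan w (mem_filter.mpr ⟨hw, h⟩))
  have hF : F = ∑ w ∈ s.filter (fun w => δ w = 2), C (r w) * N w := by
    rw [← hcoeff 2 (hkill 2 le_rfl), Polynomial.coeff_X_pow_mul', if_pos le_rfl, Nat.sub_self,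
      Polynomial.coeff_C_zero]
  rw [hF]
  exact NonnegCoeff.sum fun w hw => hterm w (mem_filter.mp hw).1

end Scaling



section Words

variable {ι J : Type*} [Fintype ι] [Fintype J]

omit [Fintype ι] in
/-- **Structure of a scaled Handelman word at a vertex.** [folklore] With `L_j = b_j + ℓ_j`
(`b_j` a constant, `ℓ_j` linear) and `A = {j | b_j = 0}` the active set, the scaled word
`∏_j L_j^{w_j}` is `t^δ · ∏_{j ∈ A} ℓ_j^{w_j} · (∏_{j ∉ A} b_j^{w_j} + t·G)` with
`δ = ∑_{j∈A} w_j`. -/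
private theorem scaleHom_word [DecidableEq J] (b : J → ℝ) (ℓ : J → MvPolynomial ι ℝ)
    (hℓ : ∀ j, scaleHom (ℓ j) = Polynomial.X * Polynomial.C (ℓ j)) (w : J → ℕ) (A : Finset J)
    (hA : ∀ j, j ∈ A ↔ b j = 0) :
    ∃ G : (MvPolynomial ι ℝ)[X],
      scaleHom (∏ j, (C (b j) + ℓ j) ^ w j) =
        Polynomial.X ^ (∑ j ∈ A, w j) * (Polynomial.C (∏ j ∈ A, ℓ j ^ w j) *
          (Polynomial.C (C (∏ j ∈ Aᶜ, b j ^ w j)) + Polynomial.X * G)) := by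
  set P₂ : (MvPolynomial ι ℝ)[X] :=
    ∏ j ∈ Aᶜ, (Polynomial.C (C (b j)) + Polynomial.X * Polynomial.C (ℓ j)) ^ w j with hP₂
  refine ⟨P₂.divX, ?_⟩
  have himg : ∀ j, scaleHom ((C (b j) + ℓ j) ^ w j) =
      (Polynomial.C (C (b j)) + Polynomial.X * Polynomial.C (ℓ j)) ^ w j := by
    intro j; rw [map_pow, map_add, scaleHom_C, hℓ]
  rw [map_prod, ← prod_mul_prod_compl A]
  simp_rw [himg]
  have hAprod : ∏ j ∈ A, (Polynomial.C (C (b j)) + Polynomial.X * Polynomial.C (ℓ j)) ^ w j =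
      Polynomial.X ^ (∑ j ∈ A, w j) * Polynomial.C (∏ j ∈ A, ℓ j ^ w j) := by
    rw [map_prod, ← prod_pow_eq_pow_sum, ← prod_mul_distrib]
    refine prod_congr rfl fun j hj => ?_
    rw [(hA j).mp hj, map_zero, map_zero, zero_add, mul_pow, map_pow]
  have hcoeff0 : P₂.coeff 0 = C (∏ j ∈ Aᶜ, b j ^ w j) := by
    rw [Polynomial.coeff_zero_eq_eval_zero, hP₂, Polynomial.eval_prod, map_prod]
    refine prod_congr rfl fun j _ => ?_
    rw [Polynomial.eval_pow, Polynomial.eval_add, Polynomial.eval_C, Polynomial.eval_mul,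
      Polynomial.eval_X, zero_mul, add_zero, map_pow]
  have hsplit : P₂ = Polynomial.C (C (∏ j ∈ Aᶜ, b j ^ w j)) + Polynomial.X * P₂.divX := by
    conv_lhs => rw [← Polynomial.divX_mul_X_add P₂]
    rw [hcoeff0]; ring
  rw [hAprod, ← hP₂]
  conv_lhs => rw [hsplit]
  ring

/-- The quadratic form `F = (y_{i₁} − y_{i₂})² + ∑_i y_i²` of [cite: Handelman1988, §III]
(our choice of witness; Handelman's `f_N` is a different quadratic). -/
private def sqForm (i₁ i₂ : ι) : MvPolynomial ι ℝ := (X i₁ - X i₂) * (X i₁ - X i₂) + ∑ i, X i * X i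

/-- `F` is homogeneous of degree two: `scaleHom F = t² F`. [folklore] -/
private theorem scaleHom_sqForm (i₁ i₂ : ι) :
    scaleHom (sqForm i₁ i₂) = Polynomial.X ^ 2 * Polynomial.C (sqForm i₁ i₂) := by
  have h2 : scaleHom ((X i₁ - X i₂) * (X i₁ - X i₂) : MvPolynomial ι ℝ) =
      Polynomial.X ^ 2 * Polynomial.C ((X i₁ - X i₂) * (X i₁ - X i₂)) := by
    rw [map_mul, map_sub, scaleHom_X, scaleHom_X, map_mul, map_sub]; ring
  have h3 : ∀ i, scaleHom (X i * X i : MvPolynomial ι ℝ) =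
      Polynomial.X ^ 2 * Polynomial.C (X i * X i) := by
    intro i; rw [map_mul, scaleHom_X, map_mul]; ring
  rw [sqForm, map_add, map_sum, h2]
  simp_rw [h3]
  rw [← Finset.mul_sum, ← map_sum, ← mul_add, ← map_add]

/-- The coefficient of `y_{i₁} y_{i₂}` in `F` is `−2`. [folklore] -/
private theorem coeff_sqForm [DecidableEq ι] {i₁ i₂ : ι} (hne : i₁ ≠ i₂) :
    coeff (Finsupp.single i₁ 1 + Finsupp.single i₂ 1) (sqForm i₁ i₂) = -2 := by
  have hXX : ∀ i j : ι, coeff (Finsupp.single i₁ 1 + Finsupp.single i₂ 1)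
      (X i * X j : MvPolynomial ι ℝ) =
        if Finsupp.single i 1 + Finsupp.single j 1 = Finsupp.single i₁ 1 + Finsupp.single i₂ 1
        then 1 else 0 := by
    intro i j
    rw [X, X, monomial_mul, coeff_monomial, mul_one]
  have hsq : ∀ i : ι, Finsupp.single i 1 + Finsupp.single i 1 ≠
      Finsupp.single i₁ 1 + Finsupp.single i₂ 1 := by
    intro i h
    have h' := DFunLike.congr_fun h i
    simp only [Finsupp.coe_add, Pi.add_apply, Finsupp.single_eq_same,
      Finsupp.single_apply] at h'
    split_ifs at h' with h1 h2 <;> first | omega | exact hne (h1.trans h2.symm)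
  have h12 : Finsupp.single i₂ 1 + Finsupp.single i₁ 1 =
      Finsupp.single i₁ 1 + Finsupp.single i₂ 1 := add_comm _ _
  simp only [sqForm, coeff_add, coeff_sub, coeff_sum, sub_mul, mul_sub, hXX, hsq, if_false, h12,
    if_true, sum_const_zero]
  norm_num

/-- `F` does not have non-negative coefficients. [folklore] -/
private theorem not_nonnegCoeff_sqForm [DecidableEq ι] {i₁ i₂ : ι} (hne : i₁ ≠ i₂) :
    ¬ NonnegCoeff (sqForm i₁ i₂) := fun h => by
  have h' := h (Finsupp.single i₁ 1 + Finsupp.single i₂ 1)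
  rw [coeff_sqForm hne] at h'
  norm_num at h'

/-- **The y-side contradiction.** [cite: Handelman1988, §III] (our proof: the graded argument in
place of Handelman's order ideals). In simplex coordinates `y` at a vertex, every generator is
`L_j = b_j + ∑_i (β_{ji} − b_j) y_i` with `b_j = β_j(v) ≥ 0` and `β_{ji} = β_j(p_i) ≥ 0`; no
combination with coefficients `≥ 0` of products of the `L_j` equals
`F = (y₁ − y₂)² + ∑_i y_i²`. -/
private theorem sum_prod_vertexForm_ne_sqForm [DecidableEq ι] (b : J → ℝ) (e : J → ι → ℝ)
    (hb : ∀ j, 0 ≤ b j) (he : ∀ j i, 0 ≤ e j i) (s : Finset (J →₀ ℕ)) (r : (J →₀ ℕ) → ℝ)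
    (hr : ∀ w ∈ s, 0 ≤ r w) {i₁ i₂ : ι} (hne : i₁ ≠ i₂)
    (hQ : ∑ w ∈ s, C (r w) * ∏ j, (C (b j) + ∑ i, C (e j i - b j) * X i) ^ w j =
      sqForm i₁ i₂) : False := by
  classical
  set ℓ : J → MvPolynomial ι ℝ := fun j => ∑ i, C (e j i - b j) * X i with hℓdef
  set A : Finset J := univ.filter fun j => b j = 0 with hAdef
  have hA : ∀ j, j ∈ A ↔ b j = 0 := fun j => by simp [hAdef]
  have hℓ : ∀ j, scaleHom (ℓ j) = Polynomial.X * Polynomial.C (ℓ j) := by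
    intro j
    have h := scaleHom_affine (ι := ι) 0 (fun i => e j i - b j)
    simpa [hℓdef] using h
  choose G hG using fun w : J →₀ ℕ => scaleHom_word b ℓ hℓ w A hA
  set δ : (J →₀ ℕ) → ℕ := fun w => ∑ j ∈ A, w j with hδ
  set κ : (J →₀ ℕ) → ℝ := fun w => ∏ j ∈ Aᶜ, b j ^ w j with hκ
  set M : (J →₀ ℕ) → MvPolynomial ι ℝ := fun w => ∏ j ∈ A, ℓ j ^ w j with hM
  have hκpos : ∀ w, 0 < κ w := fun w =>
    prod_pos fun j hj => pow_pos (lt_of_le_of_ne (hb j) (Ne.symm (by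
      have := (hA j).not.mp (Finset.mem_compl.mp hj); exact this))) _
  have hMnn : ∀ w, NonnegCoeff (M w) := fun w =>
    NonnegCoeff.prod fun j hj => NonnegCoeff.pow (NonnegCoeff.sum fun i _ =>
      (NonnegCoeff.C_nonneg (by rw [(hA j).mp hj, sub_zero]; exact he j i)).mul
        (NonnegCoeff.X i)) _
  have hE : ∑ w ∈ s, Polynomial.C (C (r w)) * scaleHom (∏ j, (C (b j) + ℓ j) ^ w j) =
      Polynomial.X ^ 2 * Polynomial.C (sqForm i₁ i₂) := by
    rw [← scaleHom_sqForm, ← hQ, map_sum]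
    exact sum_congr rfl fun w _ => by rw [map_mul, scaleHom_C]
  have hnn : NonnegCoeff (sqForm i₁ i₂) := by
    refine nonnegCoeff_of_sum_eq_X_sq_mul s r hr
      (fun w => scaleHom (∏ j, (C (b j) + ℓ j) ^ w j)) δ (fun w => C (κ w) * M w)
      (fun w _ => (NonnegCoeff.C_nonneg (hκpos w).le).mul (hMnn w))
      (fun w _ k hk => by rw [hG w]; exact coeff_X_pow_mul_of_lt _ _ _ _ hk)
      (fun w _ => by rw [hG w]; exact coeff_X_pow_mul_self _ _ _ _)
      (fun w _ h0 => ?_) (sqForm i₁ i₂) hE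
    -- `r_w κ_w M_w = 0` forces `r_w T_w = 0`
    rw [← mul_assoc, ← map_mul] at h0
    rcases mul_eq_zero.mp h0 with h | h
    · rw [map_eq_zero_iff _ (C_injective ι ℝ)] at h   -- C (r κ) = 0 → r κ = 0
      rcases mul_eq_zero.mp h with h' | h'
      · rw [h', map_zero, map_zero, zero_mul]
      · exact absurd h' (hκpos w).ne'
    · have h' : ∏ j ∈ A, ℓ j ^ w j = 0 := h
      rw [hG w, h', map_zero, zero_mul, mul_zero, mul_zero]
  exact not_nonnegCoeff_sqForm hne hnn

end Words

section Vertex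

variable {ι : Type*} [Fintype ι]

/-- Simplex coordinates at a vertex `v` (Sherman–Morrison form): with `u = x₀ − v`, `ρ ≠ 0` and
`σ' = ρ + ∑_k u_k ≠ 0`, `γ_i(x) = ρ⁻¹((x_i − v_i) − (u_i/σ') ∑_k (x_k − v_k))` is the `i`-th
coordinate of `x` in the affine frame `v; v + u + ρ e_i (i ∈ ι)`. [folklore] -/
private def vtxCoord (v u : ι → ℝ) (ρ σ' : ℝ) (i : ι) : MvPolynomial ι ℝ :=
  C ρ⁻¹ * ((X i - C (v i)) - C (u i / σ') * ∑ k, (X k - C (v k)))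

/-- The point with simplex coordinates `y`: `v + ∑_i y_i (u + ρ e_i)`. [folklore] -/
private def vtxPoint (v u : ι → ℝ) (ρ : ℝ) (y : ι → ℝ) : ι → ℝ :=
  fun k => v k + u k * (∑ i, y i) + ρ * y k

/-- Evaluation of the simplex coordinate `γ_i`. [folklore] -/
private theorem eval_vtxCoord (v u : ι → ℝ) (ρ σ' : ℝ) (i : ι) (x : ι → ℝ) :
    eval x (vtxCoord v u ρ σ' i) = ρ⁻¹ * ((x i - v i) - u i / σ' * ∑ k, (x k - v k)) := by
  simp [vtxCoord, map_sum]

/-- The apex: `x(0) = v`. [folklore] -/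
private theorem vtxPoint_zero (v u : ι → ℝ) (ρ : ℝ) : vtxPoint v u ρ 0 = v := by
  ext k; simp [vtxPoint]

/-- The edge points: `x(e_i) = v + u + ρ e_i`. [folklore] -/
private theorem vtxPoint_single [DecidableEq ι] (v u : ι → ℝ) (ρ : ℝ) (i : ι) :
    vtxPoint v u ρ (Pi.single i 1) = v + u + Pi.single i ρ := by
  ext k
  simp only [vtxPoint, Pi.add_apply, Pi.single_apply]
  split_ifs <;> simp

/-- `γ(x(y)) = y`. [folklore] -/
private theorem eval_vtxPoint_vtxCoord (v u : ι → ℝ) {ρ σ' : ℝ} (hρ : ρ ≠ 0) (hσ : σ' ≠ 0)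
    (hσ' : σ' = ρ + ∑ k, u k) (y : ι → ℝ) (i : ι) :
    eval (vtxPoint v u ρ y) (vtxCoord v u ρ σ' i) = y i := by
  rw [eval_vtxCoord]
  have hsum : ∑ k, (vtxPoint v u ρ y k - v k) = σ' * ∑ i, y i := by
    have hk : ∀ k, vtxPoint v u ρ y k - v k = u k * (∑ i, y i) + ρ * y k := fun k => by
      simp only [vtxPoint]; ring
    simp_rw [hk]
    rw [sum_add_distrib, ← sum_mul, ← mul_sum, hσ']; ring
  rw [hsum]
  simp only [vtxPoint]
  field_simp
  ring

/-- `x(γ(x)) = x`. [folklore] -/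
private theorem vtxPoint_eval_vtxCoord (v u : ι → ℝ) {ρ σ' : ℝ} (hρ : ρ ≠ 0) (hσ : σ' ≠ 0)
    (hσ' : σ' = ρ + ∑ k, u k) (x : ι → ℝ) :
    vtxPoint v u ρ (fun i => eval x (vtxCoord v u ρ σ' i)) = x := by
  ext k
  simp only [vtxPoint, eval_vtxCoord]
  have hsum : ∑ i, ρ⁻¹ * ((x i - v i) - u i / σ' * ∑ k, (x k - v k)) =
      (∑ k, (x k - v k)) / σ' := by
    rw [← mul_sum, sum_sub_distrib, ← sum_mul, ← sum_div]
    have : ∑ k, u k = σ' - ρ := by rw [hσ']; ring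
    rw [this]; field_simp; ring
  rw [hsum]; field_simp; ring

/-- An affine function in simplex coordinates: `β(x(y)) = β(v) + ∑_i y_i (β(p_i) − β(v))` with
`p_i = x(e_i)`. [folklore] -/
private theorem affine_vtxPoint [DecidableEq ι] (v u : ι → ℝ) (ρ : ℝ) (a : ι → ℝ) (c : ℝ)
    (y : ι → ℝ) :
    c + a ⬝ᵥ vtxPoint v u ρ y = (c + a ⬝ᵥ v) +
      ∑ i, y i * ((c + a ⬝ᵥ vtxPoint v u ρ (Pi.single i 1)) - (c + a ⬝ᵥ v)) := by
  have hp : ∀ i, c + a ⬝ᵥ vtxPoint v u ρ (Pi.single i 1) = c + a ⬝ᵥ v + a ⬝ᵥ u + ρ * a i := by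
    intro i
    rw [vtxPoint_single, dotProduct_add, dotProduct_add, dotProduct_single]
    ring
  have hx : vtxPoint v u ρ y = v + (∑ i, y i) • u + ρ • y := by
    ext k; simp only [vtxPoint, Pi.add_apply, Pi.smul_apply, smul_eq_mul]; ring
  simp_rw [hp]
  rw [hx, dotProduct_add, dotProduct_add, dotProduct_smul, dotProduct_smul, smul_eq_mul,
    smul_eq_mul]
  have hi : ∀ i, y i * ((c + a ⬝ᵥ v + a ⬝ᵥ u + ρ * a i) - (c + a ⬝ᵥ v)) =
      (a ⬝ᵥ u) * y i + ρ * (y i * a i) := fun i => by ring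
  simp_rw [hi]
  rw [sum_add_distrib, ← mul_sum, ← mul_sum, show ∑ i, y i * a i = y ⬝ᵥ a from rfl,
    dotProduct_comm y a]
  ring

end Vertex


section Witness

variable {ι J : Type*} [Fintype ι] [Fintype J]

omit [Fintype ι] in
/-- Evaluating a substitution: `(P ∘ g)(x) = P(g(x))`. [folklore] -/
private theorem eval_bind₁_eq (g : ι → MvPolynomial ι ℝ) (P : MvPolynomial ι ℝ) (x : ι → ℝ) :
    eval x (bind₁ g P) = eval (fun i => eval x (g i)) P := by
  rw [eval, eval₂Hom_bind₁]; rfl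

/-- The witness `f = F(γ_1, …, γ_d)`: the quadratic `sqForm` in the simplex coordinates at the
vertex. [cite: Handelman1988, §III] (statement); the particular witness is ours. -/
private def vtxWitness (v u : ι → ℝ) (ρ σ' : ℝ) (i₁ i₂ : ι) : MvPolynomial ι ℝ :=
  bind₁ (vtxCoord v u ρ σ') (sqForm i₁ i₂)

/-- The witness written out as `(γ_{i₁} − γ_{i₂})² + ∑ γ_i²`. [folklore] -/
private theorem vtxWitness_eq (v u : ι → ℝ) (ρ σ' : ℝ) (i₁ i₂ : ι) :
    vtxWitness v u ρ σ' i₁ i₂ =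
      (vtxCoord v u ρ σ' i₁ - vtxCoord v u ρ σ' i₂) * (vtxCoord v u ρ σ' i₁ - vtxCoord v u ρ σ' i₂)
        + ∑ i, vtxCoord v u ρ σ' i * vtxCoord v u ρ σ' i := by
  simp [vtxWitness, sqForm, map_sum, bind₁_X_right]

/-- Evaluation of the witness. [folklore] -/
private theorem eval_vtxWitness (v u : ι → ℝ) (ρ σ' : ℝ) (i₁ i₂ : ι) (x : ι → ℝ) :
    eval x (vtxWitness v u ρ σ' i₁ i₂) =
      (eval x (vtxCoord v u ρ σ' i₁) - eval x (vtxCoord v u ρ σ' i₂)) *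
          (eval x (vtxCoord v u ρ σ' i₁) - eval x (vtxCoord v u ρ σ' i₂))
        + ∑ i, eval x (vtxCoord v u ρ σ' i) * eval x (vtxCoord v u ρ σ' i) := by
  rw [vtxWitness_eq]; simp [map_sum]

/-- The generators in simplex coordinates: `β_j ∘ x(·) = β_j(v) + ∑_i (β_j(p_i) − β_j(v)) y_i`,
i.e. substituting the coordinates `γ` into the vertex form of `β_j` returns `β_j`. [folklore] -/
private theorem bind₁_vtxCoord_vertexForm [DecidableEq ι] (v u : ι → ℝ) {ρ σ' : ℝ} (hρ : ρ ≠ 0)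
    (hσ : σ' ≠ 0) (hσ' : σ' = ρ + ∑ k, u k) (a : ι → ℝ) (c : ℝ) :
    bind₁ (vtxCoord v u ρ σ') (C (c + a ⬝ᵥ v) +
      ∑ i, C ((c + a ⬝ᵥ vtxPoint v u ρ (Pi.single i 1)) - (c + a ⬝ᵥ v)) * X i) =
      affineForm a c := by
  apply MvPolynomial.funext
  intro x
  rw [eval_bind₁_eq, eval_affineForm]
  have hx := vtxPoint_eval_vtxCoord v u hρ hσ hσ' x
  conv_rhs => rw [← hx, affine_vtxPoint]
  simp only [map_add, map_sum, map_mul, eval_C, eval_X]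
  exact congrArg _ (sum_congr rfl fun i _ => mul_comm _ _)

/-- **Transport of a representation to simplex coordinates.** [folklore] If the witness were a
combination with coefficients `≥ 0` of products of the `β_j`, substituting `x = x(y)` would
express `F = sqForm` through the vertex forms `β_j(v) + ∑_i (β_j(p_i) − β_j(v)) y_i`, which
`sum_prod_vertexForm_ne_sqForm` forbids. -/
private theorem vtxWitness_not_repr [DecidableEq ι] (v u : ι → ℝ) {ρ σ' : ℝ} (hρ : ρ ≠ 0)
    (hσ : σ' ≠ 0)
    (hσ' : σ' = ρ + ∑ k, u k) (a : J → ι → ℝ) (c : J → ℝ) (hb : ∀ j, 0 ≤ c j + a j ⬝ᵥ v)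
    (he : ∀ j i, 0 ≤ c j + a j ⬝ᵥ vtxPoint v u ρ (Pi.single i 1)) {i₁ i₂ : ι} (hne : i₁ ≠ i₂)
    (s : Finset (J →₀ ℕ)) (r : (J →₀ ℕ) → ℝ) (hr : ∀ w ∈ s, 0 ≤ r w)
    (hrepr : vtxWitness v u ρ σ' i₁ i₂ = ∑ w ∈ s, C (r w) * ∏ j, affineForm (a j) (c j) ^ w j) :
    False := by
  have hΓL := fun j => bind₁_vtxCoord_vertexForm v u hρ hσ hσ' (a j) (c j)
  -- pull the representation back along `bind₁ γ` …
  have hΓQ : bind₁ (vtxCoord v u ρ σ')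
      (∑ w ∈ s, C (r w) * ∏ j, (C (c j + a j ⬝ᵥ v) +
        ∑ i, C ((c j + a j ⬝ᵥ vtxPoint v u ρ (Pi.single i 1)) - (c j + a j ⬝ᵥ v)) * X i) ^ w j) =
      vtxWitness v u ρ σ' i₁ i₂ := by
    rw [hrepr, map_sum]
    refine sum_congr rfl fun w _ => ?_
    rw [map_mul, bind₁_C_right, map_prod]
    simp_rw [map_pow, hΓL]
  -- … and, `x ↦ γ(x)` being onto, read it as `∑ r_w ∏ L_j^{w_j} = F`
  have key : ∀ (y : ι → ℝ) (P : MvPolynomial ι ℝ),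
      eval y P = eval (vtxPoint v u ρ y) (bind₁ (vtxCoord v u ρ σ') P) := by
    intro y P
    rw [eval_bind₁_eq]
    exact congrArg (fun z => eval z P)
      (funext fun i => (eval_vtxPoint_vtxCoord v u hρ hσ hσ' y i).symm)
  have hQ : ∑ w ∈ s, C (r w) * ∏ j, (C (c j + a j ⬝ᵥ v) +
      ∑ i, C ((c j + a j ⬝ᵥ vtxPoint v u ρ (Pi.single i 1)) - (c j + a j ⬝ᵥ v)) * X i) ^ w j =
      sqForm i₁ i₂ := by
    apply MvPolynomial.funext
    intro y
    rw [key y, hΓQ, key y (sqForm i₁ i₂)]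
    rfl
  exact sum_prod_vertexForm_ne_sqForm (fun j => c j + a j ⬝ᵥ v)
    (fun j i => c j + a j ⬝ᵥ vtxPoint v u ρ (Pi.single i 1)) hb he s r hr hne hQ

end Witness

end HandelmanSectionIII

section Main

open HandelmanSectionIII

variable {ι J : Type*} [Fintype ι] [Fintype J]

/-- **Handelman 1988, §III: an almost non-vanishing element that is not positive.**
[cite: Handelman1988, §III] (D. Handelman, *Representing polynomials by positive linear functions
on compact convex polyhedra*, Pacific J. Math. 132 (1988) 35–62, p. 56, items (i)–(iv)).
For a compact polyhedron `K = {x | β_j(x) = c_j + a_j·x ≥ 0} ⊆ ℝ^d`, `d ≥ 2`, with interior,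
there is a polynomial `f` that is (i) non-negative on `K`, (ii) a sum of squares, (iii) vanishes
on `K` exactly at one vertex `v`, and (iv) is NOT a combination with non-negative coefficients of
products of the `β_j` — so the interiority hypothesis of `handelman_polytope` cannot be weakened
to "vanishes only at a vertex".  The statement is Handelman's; the witness
(`f = (γ₁−γ₂)² + ∑ γ_i²` in simplex coordinates at `v`) and the proof (grading by the scaling
`y ↦ t y` in place of Handelman's order ideals) are ours. -/
theorem exists_isSumSq_eq_zero_iff_vertex_not_repr [DecidableEq ι] [Nontrivial ι]
    (a : J → ι → ℝ) (c : J → ℝ)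
    (hK : IsCompact {x : ι → ℝ | ∀ j, 0 ≤ c j + a j ⬝ᵥ x})
    (hint : (interior {x : ι → ℝ | ∀ j, 0 ≤ c j + a j ⬝ᵥ x}).Nonempty) :
    ∃ f : MvPolynomial ι ℝ,
      (∀ x, (∀ j, 0 ≤ c j + a j ⬝ᵥ x) → 0 ≤ eval x f) ∧ IsSumSq f ∧
      (∃ v ∈ Set.extremePoints ℝ {x : ι → ℝ | ∀ j, 0 ≤ c j + a j ⬝ᵥ x},
        ∀ x, ((∀ j, 0 ≤ c j + a j ⬝ᵥ x) ∧ eval x f = 0) ↔ x = v) ∧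
      ¬ ∃ (s : Finset (J →₀ ℕ)) (r : (J →₀ ℕ) → ℝ), (∀ w ∈ s, 0 ≤ r w) ∧
        f = ∑ w ∈ s, C (r w) * ∏ j, affineForm (a j) (c j) ^ w j := by
  classical
  obtain ⟨x₀, hx₀⟩ := hint
  obtain ⟨ε, hε, hball⟩ := Metric.mem_nhds_iff.mp (mem_interior_iff_mem_nhds.mp hx₀)
  have hx₀K : ∀ j, 0 ≤ c j + a j ⬝ᵥ x₀ := interior_subset hx₀
  obtain ⟨v, hv⟩ := hK.extremePoints_nonempty ⟨x₀, hx₀K⟩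
  have hvK : ∀ j, 0 ≤ c j + a j ⬝ᵥ v := hv.1
  obtain ⟨ρ, hρ, hρε, hσ⟩ : ∃ ρ : ℝ, 0 < ρ ∧ ρ < ε ∧ ρ + ∑ k, (x₀ - v) k ≠ 0 := by
    by_cases h : 0 ≤ ∑ k, (x₀ - v) k
    · exact ⟨ε / 2, by positivity, by linarith, ne_of_gt (by linarith)⟩
    · rw [not_le] at h
      refine ⟨min (ε / 2) (-(∑ k, (x₀ - v) k) / 2), lt_min (by positivity) (by linarith),
        lt_of_le_of_lt (min_le_left _ _) (by linarith), ne_of_lt ?_⟩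
      have := min_le_right (ε / 2) (-(∑ k, (x₀ - v) k) / 2)
      linarith
  have hρ0 : ρ ≠ 0 := hρ.ne'
  -- the edge points `p_i = x₀ + ρ e_i` of the auxiliary simplex lie in `K`
  have hpK : ∀ i j, 0 ≤ c j + a j ⬝ᵥ vtxPoint v (x₀ - v) ρ (Pi.single i 1) := by
    intro i
    have hmem : vtxPoint v (x₀ - v) ρ (Pi.single i 1) ∈
        {x : ι → ℝ | ∀ j, 0 ≤ c j + a j ⬝ᵥ x} := by
      apply hball
      rw [Metric.mem_ball, dist_eq_norm, vtxPoint_single,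
        show v + (x₀ - v) + Pi.single i ρ - x₀ = Pi.single i ρ by abel, Pi.norm_single,
        Real.norm_eq_abs, abs_of_pos hρ]
      exact hρε
    exact hmem
  obtain ⟨i₁, i₂, hne⟩ := exists_pair_ne ι
  refine ⟨vtxWitness v (x₀ - v) ρ (ρ + ∑ k, (x₀ - v) k) i₁ i₂, ?_, ?_, ⟨v, hv, ?_⟩, ?_⟩
  · -- (i) non-negative everywhere
    intro x _
    rw [eval_vtxWitness]
    exact add_nonneg (mul_self_nonneg _) (sum_nonneg fun i _ => mul_self_nonneg _)
  · -- (ii) a sum of squares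
    rw [vtxWitness_eq]
    exact IsSumSq.add (IsSumSq.mul_self _) (IsSumSq.sum_mul_self _ _)
  · -- (iii) on `K` it vanishes exactly at the vertex `v`
    intro x
    constructor
    · rintro ⟨-, hfx⟩
      rw [eval_vtxWitness] at hfx
      have h2 : ∀ i ∈ (univ : Finset ι),
          0 ≤ eval x (vtxCoord v (x₀ - v) ρ (ρ + ∑ k, (x₀ - v) k) i) *
            eval x (vtxCoord v (x₀ - v) ρ (ρ + ∑ k, (x₀ - v) k) i) := fun i _ => mul_self_nonneg _
      have hsum : ∑ i, eval x (vtxCoord v (x₀ - v) ρ (ρ + ∑ k, (x₀ - v) k) i) *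
          eval x (vtxCoord v (x₀ - v) ρ (ρ + ∑ k, (x₀ - v) k) i) = 0 := by
        have h1 := mul_self_nonneg (eval x (vtxCoord v (x₀ - v) ρ (ρ + ∑ k, (x₀ - v) k) i₁) -
          eval x (vtxCoord v (x₀ - v) ρ (ρ + ∑ k, (x₀ - v) k) i₂))
        have h3 := sum_nonneg h2
        linarith
      have hy : ∀ i, eval x (vtxCoord v (x₀ - v) ρ (ρ + ∑ k, (x₀ - v) k) i) = 0 := fun i =>
        mul_self_eq_zero.mp ((sum_eq_zero_iff_of_nonneg h2).mp hsum i (mem_univ i))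
      have hx := vtxPoint_eval_vtxCoord v (x₀ - v) hρ0 hσ rfl x
      rw [← hx, show (fun i => eval x (vtxCoord v (x₀ - v) ρ (ρ + ∑ k, (x₀ - v) k) i)) = 0 from
        funext hy, vtxPoint_zero]
    · rintro rfl
      refine ⟨hvK, ?_⟩
      rw [eval_vtxWitness]
      simp [eval_vtxCoord]
  · -- (iv) not in the cone generated by products of the `β_j`
    rintro ⟨s, r, hr, hrepr⟩
    exact vtxWitness_not_repr v (x₀ - v) hρ0 hσ rfl a c hvK (fun j i => hpK i j) hne s r hr hrepr

end Main

end Literature.Algebra.Polynomial
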